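import Summits.BirchSwinnertonDyer.Rank1Residual.X11a.AnomalousLineKummer
import Summits.BirchSwinnertonDyer.Rank1Residual.X11a.SelmerCompanionTateLineStrict
import HarnessLib

/-!
# Route (3e) SELMER COMPANION, XXXIII: at most `p²` classes on a FIXED line and at most `p`
# classes of `H¹(ℚ_v, A)` valued in it — the counting half of lemma G1 (class X11a = N7;
# cell `b2b-bsdres`, unit `b2b-bsdres-x11a`, gen 31)

HONEST FRAMING (run/shared/lean/b2b/bsd-rank1-residual/, verbatim in every file): the goal of the
cell is to DELETE the COMBINATION-SHAPED residual classes of the Birch–Swinnerton-Dyer formula for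
ALL analytic-rank `≤ 1` elliptic curves over `ℚ` — "full BSD formula for every rank `≤ 1` curve in
class `C`" assembled STRICTLY from published theorems — so that the rank-`≤ 1` remainder becomes
exactly the CONSTRUCTION-SHAPED classes, which are TYPED (missing-input `Prop`s), NOT attempted.
This is not "finishing BSD". CLASS-OWNERS.md: research routes; NO CLAIM BEYOND STATED CLASSES.
THEOREMS ONLY (no definition, no named fact, no `sorry`); nothing is booked by this file; no label
moves. CONDITIONAL on Tate's local Euler characteristic (`hEP`, Milne *ADT* I Thm. 2.8, the
tree's named fact `localEulerPoincareCharacteristic`; discharged in the tree at `ℓ ≠ p`).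

## What this file proves

Shape G (gen 31, files XXXI–XXXII; `HOME/b2b-bsdres-x11a/REPORT-g31.md` §3): at a FULL-`p`-TORSION
level-raising place `v ∤ p` of `E` (`E` split multiplicative, `E(ℚ_v)[p] = E[p]`) with the partner
`A` GOOD at `v`, the transported condition `θ_* 𝓢_v(E)` is, locally, "classes valued in the line
`Λ = θ(Tate line of E)`", a line of `A[p] ⊂ A(K̄_v)` FIXED pointwise by `Γ_{ℚ_v}` (`μ_p ⊂ ℚ_v`).
The census charged the crude index `#E(ℚ_v)[p] = p²`; the true comparison index is `≤ p`. This file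
proves the two counting statements behind that bound, in the form of files XVIII-b (at `p`):

* `natCard_H1_le_sq_of_fixed_line` — for a `Γ`-stable line `C ≤ A(K̄_v)` of order `p` FIXED
  pointwise by `Γ = Γ_{ℚ_v}`, `v ∤ p`: `#H¹(Γ, C) ≤ p²`. (`C^Γ = C` has `p` elements;
  `#H²(Γ, C) = #Hom_Γ(C, μ_p) ≤ p` by local duality in bidegree `(2,0)` (tree theorem); Tate's
  Euler characteristic with `#(ℤ_v/p) = 1`; = file XVIII-a's `natCard_H1_le_sq_of_line` with the
  twist (α) replaced by triviality of the action and `v ∣ p` by `v ∤ p`.)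
* `exists_small_set_of_lineValued_classes` — with such a `C = ℤ·L₀` and ONE point
  `h ∈ A(K̄_v)` with `σh − h ∈ C` for all `σ` and `σ₁h ≠ h` for some `σ₁` (`hpt`: a `p`-th root of
  a rational point whose Kummer class points along `L₀`; per pair a finite certificate), the
  classes in `H¹(ℚ_v, A)` of the `C`-valued cocycles form a set of AT MOST `p` elements: the
  `p` coboundaries `∂(i·h)`, `i < p`, are `C`-valued cocycles with pairwise distinct classes in
  `H¹(Γ, C)` (two of them with the same class differ by `∂c`, `c ∈ C`, which is `0` since `C` is
  fixed; and `σ₁h − h` has order `p`), all dying in `A(K̄_v)`, so the counting lemma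
  `exists_small_set_of_classes_of_kernel` (file XVIII-b) applies.

File XXXIV turns this into the comparison index `ι_v(θ) ≤ p` and the shape-G booking theorem.
References: [MilneADT2006] I Thm. 2.8, Cor. 2.3; [SerreGaloisCohomology1997] I.§2, II.§5;
[MazurRubin2004] §2.3; tree files XVIII-a/b; HOME/b2b-bsdres-x11a/REPORT-g31.md.
-/

set_option autoImplicit false

noncomputable section

open scoped Classical NNReal

open WeierstrassCurve Literature.NumberTheory.EllipticCurves
  Literature.NumberTheory.GaloisRepresentations Field NumberField IsDedekindDomain
  IsDedekindDomain.HeightOneSpectrum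

namespace Summit.BirchSwinnertonDyer.Rank1Residual.X11a.OrdinaryLine

variable {v : HeightOneSpectrum (𝓞 ℚ)} {p : ℕ} [hp : Fact p.Prime]

open _root_.TopRep _root_.ContRepresentation _root_.ContinuousCohomology DiscreteGaloisModule

/-- **`#H¹(Γ_{ℚ_v}, C) ≤ p²` for a line `C ≤ E(K̄_v)` of order `p` FIXED pointwise by `Γ_{ℚ_v}`,
`v ∤ p`.** `C^Γ = C` (`p` elements), `#H²(Γ, C) = #Hom_Γ(C, μ_p) ≤ #Hom(C, μ_p) ≤ p` (`C` cyclic;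
local duality in bidegree `(2,0)`, tree theorem `natCard_two_eq_natCard_invariants_homRep`) and
Tate's local Euler–Poincaré characteristic (`hEP`) with `#(ℤ_v/p) = 1` (`v ∤ p`). `H¹` is Mathlib's
`continuousCohomology 1` of the sub-representation of `E(K̄_v)` on `C`.
[cite: MilneADT2006, Ch. I §2, Thm. 2.8 and Cor. 2.3] -/
theorem natCard_H1_le_sq_of_fixed_line (hEP : localEulerPoincareCharacteristic (v.adicCompletion ℚ))
    (hpv : (p : 𝓞 ℚ) ∉ v.asIdeal) (W : WeierstrassCurve ℚ)
    (C : Submodule ℤ (localPoints W (v.adicCompletion ℚ)))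
    (hC : ∀ σ : absoluteGaloisGroup (v.adicCompletion ℚ),
      C ≤ C.comap ((W.localGaloisModule (v.adicCompletion ℚ)) σ))
    [Finite C] (hcard : Nat.card C = p)
    (hfix : ∀ (σ : absoluteGaloisGroup (v.adicCompletion ℚ))
      (T : localPoints W (v.adicCompletion ℚ)), T ∈ C → σ • T = T) :
    Finite (continuousCohomology 1
      (ContinuousRep.subrepresentation (W.localGaloisModule (v.adicCompletion ℚ)) C hC).toTopRep) ∧
    Nat.card (continuousCohomology 1
      (ContinuousRep.subrepresentation (W.localGaloisModule (v.adicCompletion ℚ)) C hC).toTopRep)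
        ≤ p ^ 2 := by
  have hpp : p.Prime := hp.out
  haveI := absoluteGaloisGroup_compactSpace (v.adicCompletion ℚ)
  haveI : NeZero ((p : ℕ) : v.adicCompletion ℚ) := ⟨by
    rw [← map_natCast (algebraMap ℚ (v.adicCompletion ℚ))]
    exact (map_ne_zero _).mpr (Nat.cast_ne_zero.mpr hpp.ne_zero)⟩
  set ρC := ContinuousRep.subrepresentation (W.localGaloisModule (v.adicCompletion ℚ)) C hC with hρC
  have hcardC' : Nat.card C.toAddSubgroup = p := hcard
  haveI : Finite C.toAddSubgroup := ‹Finite C›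
  have hcyc : ∀ {T₁ : localPoints W (v.adicCompletion ℚ)}, T₁ ∈ C → T₁ ≠ 0 →
      ∀ {T : localPoints W (v.adicCompletion ℚ)}, T ∈ C → ∃ k : ℤ, k • T₁ = T :=
    fun {T₁} hT₁ hT₁0 {T} hT ↦ exists_zsmul_eq_of_card_prime C.toAddSubgroup hcardC' hT₁ hT₁0 hT
  have hρC_apply : ∀ (σ : absoluteGaloisGroup (v.adicCompletion ℚ)) (m : C),
      ((ρC σ m : C) : localPoints W (v.adicCompletion ℚ)) =
        σ • (m : localPoints W (v.adicCompletion ℚ)) := fun σ m ↦ rfl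
  -- `C^Γ = C` has `p` elements
  have hinv : Nat.card ρC.toTopRep.ρ.invariants = p := by
    have hbij : Function.Bijective (fun z : ρC.toTopRep.ρ.invariants ↦ (z.1 : C)) := by
      refine ⟨fun x y h ↦ Subtype.ext h, fun m ↦ ?_⟩
      refine ⟨⟨m, (ContRepresentation.mem_invariants _).mpr fun g ↦ ?_⟩, rfl⟩
      exact Subtype.ext (hfix g _ m.2)
    rw [Nat.card_eq_of_bijective _ hbij, hcard]
  -- a generator
  obtain ⟨T₁, hT₁, hT₁0⟩ : ∃ T₁ : localPoints W (v.adicCompletion ℚ), T₁ ∈ C ∧ T₁ ≠ 0 := by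
    by_contra h
    push Not at h
    haveI : Subsingleton C := ⟨fun a b ↦ Subtype.ext ((h a a.2).trans (h b b.2).symm)⟩
    have h1 : Nat.card C = 1 := Nat.card_of_subsingleton (0 : C)
    rw [hcard] at h1
    exact hpp.one_lt.ne' h1
  -- `#H² = #Hom_Γ(C, μ_p) ≤ #Hom(C, μ_p) ≤ p`
  have hM : ∀ m : C, p ^ 1 • m = 0 := fun m ↦ by
    rw [pow_one, ← hcard]; exact card_nsmul_eq_zero'
  have hcardMu : Nat.card (DiscreteGaloisModule.MuCarrier (v.adicCompletion ℚ) (p ^ 1)) = p ^ 1 :=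
    HasEnoughRootsOfUnity.natCard_rootsOfUnity (AlgebraicClosure (v.adicCompletion ℚ)) (p ^ 1)
  haveI : Finite (DiscreteGaloisModule.MuCarrier (v.adicCompletion ℚ) (p ^ 1)) :=
    Nat.finite_of_card_ne_zero (by rw [hcardMu, pow_one]; exact hpp.ne_zero)
  have heval : Function.Injective (fun f : HomCarrier C (DiscreteGaloisModule.MuCarrier
      (v.adicCompletion ℚ) (p ^ 1)) ↦ f ⟨T₁, hT₁⟩) := by
    intro f g hfg
    apply HomCarrier.ext
    intro m
    obtain ⟨k, hk⟩ := hcyc hT₁ hT₁0 m.2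
    have hm : m = k • (⟨T₁, hT₁⟩ : C) := Subtype.ext (by rw [← hk]; rfl)
    change f m = g m
    rw [hm, map_zsmul, map_zsmul]
    exact congrArg (k • ·) hfg
  haveI : Finite (HomCarrier C (DiscreteGaloisModule.MuCarrier (v.adicCompletion ℚ) (p ^ 1))) :=
    Finite.of_injective _ heval
  have hhom : Nat.card (ρC.homRep (DiscreteGaloisModule.mu (v.adicCompletion ℚ)
      (p ^ 1))).toTopRep.ρ.invariants ≤ p := by
    calc Nat.card (ρC.homRep (DiscreteGaloisModule.mu (v.adicCompletion ℚ) (p ^ 1))).toTopRep.ρ.invariants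
        ≤ Nat.card (HomCarrier C (DiscreteGaloisModule.MuCarrier (v.adicCompletion ℚ) (p ^ 1))) :=
          Nat.card_le_card_of_injective _ Subtype.val_injective
      _ ≤ Nat.card (DiscreteGaloisModule.MuCarrier (v.adicCompletion ℚ) (p ^ 1)) :=
          Nat.card_le_card_of_injective _ heval
      _ = p := by rw [hcardMu, pow_one]
  -- local duality in bidegree `(2,0)` and Tate's local Euler–Poincaré characteristic
  haveI : CharZero (v.adicCompletion ℚ) := charZero_adicCompletion v
  obtain ⟨-, h2⟩ := natCard_two_eq_natCard_invariants_homRep (v.adicCompletion ℚ) ρC hM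
  obtain ⟨hfin1, -, hEq⟩ := localEulerPoincareCharacteristic_adicCompletion ℚ v hEP ρC
  change Finite (continuousCohomology 1 ρC.toTopRep) at hfin1
  change _ * Nat.card (continuousCohomology 2 ρC.toTopRep) * _ =
    Nat.card (continuousCohomology 1 ρC.toTopRep) at hEq
  rw [hinv, h2, hcard, natCard_quot_adicCompletionIntegers_eq_one hpv, mul_one] at hEq
  refine ⟨hfin1, ?_⟩
  rw [← hEq, sq]
  exact Nat.mul_le_mul_left p hhom

/-- **At most `p` classes of `H¹(ℚ_v, A)` come from cocycles valued in a fixed line with a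
Kummer point.** `v ∤ p`; `L₀ ∈ A(K̄_v)` a non-zero point killed by `p` and fixed by `Γ_{ℚ_v}`;
`C = ℤ·L₀`; a point `h ∈ A(K̄_v)` with `σh − h ∈ C` for all `σ` and `σ₁h ≠ h` for some `σ₁` (`hpt`).
Then the classes in `H¹(Γ_{ℚ_v}, A(K̄_v))` of the continuous cocycles valued in `C` form a set of
at most `p` elements (`#H¹(Γ, C) ≤ p²` by `natCard_H1_le_sq_of_fixed_line`; the coboundaries
`∂(i·h)`, `i < p`, are `C`-valued with pairwise distinct classes in `H¹(Γ, C)` and die in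
`A(K̄_v)`; counting lemma of file XVIII-b). Granted `hEP`.
[cite: MilneADT2006, Ch. I §2, Thm. 2.8 and Cor. 2.3] [cite: SerreGaloisCohomology1997, I.§2.2 and I.§5.1] -/
theorem exists_small_set_of_lineValued_classes
    (hEP : localEulerPoincareCharacteristic (v.adicCompletion ℚ))
    (hpv : (p : 𝓞 ℚ) ∉ v.asIdeal) (A : WeierstrassCurve ℚ)
    {L₀ : localPoints A (v.adicCompletion ℚ)} (hL₀p : (p : ℤ) • L₀ = 0) (hL₀0 : L₀ ≠ 0)
    (hL₀fix : ∀ σ : absoluteGaloisGroup (v.adicCompletion ℚ), σ • L₀ = L₀)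
    (hpt : ∃ h : localPoints A (v.adicCompletion ℚ),
      (∀ σ : absoluteGaloisGroup (v.adicCompletion ℚ), σ • h - h ∈ AddSubgroup.zmultiples L₀) ∧
      ∃ σ₁ : absoluteGaloisGroup (v.adicCompletion ℚ), σ₁ • h ≠ h) :
    ∃ S : Set (discreteH1 (absoluteGaloisGroup (v.adicCompletion ℚ))
        (localPoints A (v.adicCompletion ℚ))),
      S.Finite ∧ Nat.card S ≤ p ∧
      ∀ (φ : contOneCocycles (discreteTopRep (absoluteGaloisGroup (v.adicCompletion ℚ))
          (localPoints A (v.adicCompletion ℚ)))),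
        (∀ σ, φ.1 σ ∈ AddSubgroup.zmultiples L₀) →
        oneCocycleClass (discreteTopRep (absoluteGaloisGroup (v.adicCompletion ℚ))
          (localPoints A (v.adicCompletion ℚ))) φ ∈ S := by
  have hpp : p.Prime := hp.out
  haveI : NeZero p := ⟨hpp.ne_zero⟩
  -- the line `C = ℤ·L₀` as a `Γ`-stable sub-`ℤ`-module
  let C : Submodule ℤ (localPoints A (v.adicCompletion ℚ)) :=
    (AddSubgroup.zmultiples L₀).toIntSubmodule
  have hmemC : ∀ T, T ∈ C ↔ T ∈ AddSubgroup.zmultiples L₀ := fun T ↦ Iff.rfl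
  have hfixC : ∀ (σ : absoluteGaloisGroup (v.adicCompletion ℚ))
      (T : localPoints A (v.adicCompletion ℚ)), T ∈ C → σ • T = T := by
    intro σ T hT
    obtain ⟨k, rfl⟩ := AddSubgroup.mem_zmultiples_iff.mp ((hmemC T).mp hT)
    rw [smul_zsmul_localPoints, hL₀fix]
  have hCstab : ∀ σ : absoluteGaloisGroup (v.adicCompletion ℚ),
      C ≤ C.comap ((A.localGaloisModule (v.adicCompletion ℚ)) σ) := by
    intro σ T hT
    rw [Submodule.mem_comap]
    change σ • T ∈ C
    rw [hfixC σ T hT]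
    exact hT
  have hordL₀ : addOrderOf L₀ = p :=
    addOrderOf_eq_prime (by rw [← natCast_zsmul]; exact hL₀p) hL₀0
  have hcardC : Nat.card C = p := by
    change Nat.card (AddSubgroup.zmultiples L₀).toIntSubmodule = p
    rw [show Nat.card (AddSubgroup.zmultiples L₀).toIntSubmodule =
      Nat.card (AddSubgroup.zmultiples L₀) from rfl, Nat.card_zmultiples, hordL₀]
  haveI hfinC : Finite C := Nat.finite_of_card_ne_zero (by rw [hcardC]; exact hpp.ne_zero)
  obtain ⟨hfinH, hcardH⟩ := natCard_H1_le_sq_of_fixed_line hEP hpv A C hCstab hcardC hfixC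
  set X := (ContinuousRep.subrepresentation (A.localGaloisModule (v.adicCompletion ℚ)) C
    hCstab).toTopRep with hX
  have mkCocycle : ∀ g : absoluteGaloisGroup (v.adicCompletion ℚ) →
      localPoints A (v.adicCompletion ℚ), Continuous g → (∀ σ τ, g (σ * τ) = g σ + σ • g τ) →
      (∀ σ, g σ ∈ C) → ∃ φ : contOneCocycles X,
        ∀ σ, ((φ.1 σ : C) : localPoints A (v.adicCompletion ℚ)) = g σ := by
    intro g hgc hg1 hgC
    refine ⟨⟨⟨fun σ ↦ ⟨g σ, hgC σ⟩, hgc.subtype_mk _⟩, fun σ τ ↦ ?_⟩, fun σ ↦ rfl⟩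
    apply Subtype.ext
    exact hg1 σ τ
  -- the Kummer point `h` and the cocycles `∂(i·h)`
  obtain ⟨h, hhC, σ₁, hσ₁⟩ := hpt
  set Q : ℕ → localPoints A (v.adicCompletion ℚ) := fun i ↦ i • h with hQdef
  have hdC : ∀ (i : ℕ) (σ : absoluteGaloisGroup (v.adicCompletion ℚ)), σ • Q i - Q i ∈ C := by
    intro i σ
    rw [hQdef]
    change σ • (i • h) - i • h ∈ C
    rw [← natCast_zsmul, smul_zsmul_localPoints, natCast_zsmul, natCast_zsmul, ← nsmul_sub]
    exact C.toAddSubgroup.nsmul_mem ((hmemC _).mpr (hhC σ)) i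
  choose φ hφ using fun i : ℕ ↦ mkCocycle (fun σ ↦ σ • Q i - Q i)
    ((continuous_smul_localPoints A (v.adicCompletion ℚ) (Q i)).sub continuous_const)
    (fun σ τ ↦ by rw [mul_smul, smul_sub]; abel) (hdC i)
  have hsub_class : ∀ ψ₁ ψ₂ : contOneCocycles X,
      oneCocycleClass X ψ₁ = oneCocycleClass X ψ₂ →
        ∃ c : C, ∀ σ, ((ψ₁.1 σ : C) : localPoints A (v.adicCompletion ℚ)) -
          ((ψ₂.1 σ : C) : localPoints A (v.adicCompletion ℚ)) =
          σ • (c : localPoints A (v.adicCompletion ℚ)) - (c : localPoints A (v.adicCompletion ℚ)) := by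
    intro ψ₁ ψ₂ h12
    have h0 : oneCocycleClass X (ψ₁ - ψ₂) = 0 := by
      have := map_sub (oneCocycleClassₗ X) ψ₁ ψ₂
      rw [oneCocycleClassₗ_apply, oneCocycleClassₗ_apply, oneCocycleClassₗ_apply, h12, sub_self]
        at this
      exact this
    obtain ⟨c, hc⟩ := (oneCocycleClass_eq_zero_iff X _).mp h0
    refine ⟨c, fun σ ↦ ?_⟩
    have h1 := congrArg (fun x : C ↦ (x : localPoints A (v.adicCompletion ℚ))) (hc σ)
    exact h1
  -- the classes `[∂(i·h)]`, `i < p`, are pairwise distinct: `C` is fixed, `σ₁ h - h` has order `p`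
  have hgen0 : σ₁ • h - h ≠ 0 := fun h0 ↦ hσ₁ (sub_eq_zero.mp h0)
  have hgenp : (p : ℤ) • (σ₁ • h - h) = 0 := by
    obtain ⟨k, hk⟩ := AddSubgroup.mem_zmultiples_iff.mp (hhC σ₁)
    rw [← hk, smul_comm, hL₀p, smul_zero]
  have hkey : ∀ i j : ℕ, j < p → i < j →
      oneCocycleClass X (φ j) = oneCocycleClass X (φ i) → False := by
    intro i j hj hij heq
    obtain ⟨c, hc⟩ := hsub_class (φ j) (φ i) heq
    have h1 := hc σ₁
    rw [hφ j σ₁, hφ i σ₁, hfixC σ₁ _ c.2, sub_self, hQdef] at h1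
    change σ₁ • (j • h) - j • h - (σ₁ • (i • h) - i • h) = 0 at h1
    obtain ⟨d, rfl⟩ : ∃ d : ℕ, j = i + d := ⟨j - i, by omega⟩
    have hd0 : 0 < d := by omega
    have hdp : ¬ p ∣ d := fun hd ↦ by have : p ≤ d := Nat.le_of_dvd hd0 hd; omega
    have e1 : σ₁ • ((i + d) • h) = (i + d) • (σ₁ • h) := by
      rw [← natCast_zsmul, smul_zsmul_localPoints, natCast_zsmul]
    have e2 : σ₁ • (i • h) = i • (σ₁ • h) := by
      rw [← natCast_zsmul, smul_zsmul_localPoints, natCast_zsmul]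
    rw [e1, e2, add_nsmul, add_nsmul] at h1
    have h2 : d • (σ₁ • h - h) = 0 := by
      calc d • (σ₁ • h - h)
          = i • σ₁ • h + d • σ₁ • h - (i • h + d • h) - (i • σ₁ • h - i • h) := by
            rw [nsmul_sub]; abel
        _ = 0 := h1
    -- an element of order `p` killed by `d` coprime to `p`
    have h3 : addOrderOf (σ₁ • h - h) ∣ d := addOrderOf_dvd_of_nsmul_eq_zero h2
    rw [addOrderOf_eq_prime (by rw [← natCast_zsmul]; exact hgenp) hgen0] at h3
    exact hdp h3
  have hinj : Set.InjOn (fun i ↦ oneCocycleClass X (φ i)) ↑(Finset.range p) := by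
    intro i hi j hj hij
    rw [Finset.coe_range, Set.mem_Iio] at hi hj
    rcases lt_trichotomy i j with hlt | heq' | hgt
    · exact (hkey i j hj hlt hij.symm).elim
    · exact heq'
    · exact (hkey j i hi hgt hij).elim
  haveI : Finite (continuousCohomology 1 X) := hfinH
  haveI := absoluteGaloisGroup_compactSpace (v.adicCompletion ℚ)
  let hconv : (X ⟶ (A.localGaloisModule (v.adicCompletion ℚ)).toTopRep) →
      (X ⟶ discreteTopRep (absoluteGaloisGroup (v.adicCompletion ℚ))
        (localPoints A (v.adicCompletion ℚ))) :=
    fun f ↦ f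
  let ι : X ⟶ discreteTopRep (absoluteGaloisGroup (v.adicCompletion ℚ))
      (localPoints A (v.adicCompletion ℚ)) :=
    hconv (subtypeHom (A.localGaloisModule (v.adicCompletion ℚ)) C hCstab)
  have hιapp : ∀ c : C, ι.hom c = (c : localPoints A (v.adicCompletion ℚ)) := fun c ↦ rfl
  obtain ⟨S, hSfin, hScard, hS⟩ := exists_small_set_of_classes_of_kernel ι hpp.pos hcardH φ hinj
    (fun i ↦ ⟨Q i, fun σ ↦ by
    rw [hιapp, hφ i σ, discreteTopRep_ρ_apply]⟩)
  refine ⟨S, hSfin, hScard, fun φY hfC ↦ ?_⟩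
  have hf1 : ∀ σ τ, φY.1 (σ * τ) = φY.1 σ + σ • φY.1 τ := fun σ τ ↦ by
    have hh := φY.2 σ τ
    rwa [discreteTopRep_ρ_apply] at hh
  obtain ⟨ψ, hψ⟩ := mkCocycle φY.1 φY.1.continuous hf1 (fun σ ↦ (hmemC _).mpr (hfC σ))
  exact hS φY ⟨ψ, fun σ ↦ by rw [hιapp, hψ σ]⟩

end Summit.BirchSwinnertonDyer.Rank1Residual.X11a.OrdinaryLine

end
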